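import Mathlib
import Literature.MathematicalPhysics.QuantumFieldTheory.MagnenRivasseauSeneor1993.MRS93LemmaVI2FeynmanGauge
import Literature.MathematicalPhysics.QuantumFieldTheory.MagnenRivasseauSeneor1993.MRS93BosonFirstOrderVI17
import HarnessLib

/-!
# Magnen–Rivasseau–Sénéor, *Construction of YM₄ with an infrared cutoff* (CMP 155, 1993), Appendix 1 (A.27): the covariant
# homothetic bound «δ_μν D² − 10/13 ∇_μ∇_ν ≥ 3/13 D²» — TRUE (kernel, with both printed constants 3/13 and 23/13) for the
# cross-term form «ΣΣ(∂_μA_ν)² + (ζ − 1)ΣΣ(∂_μA_ν)(∂_νA_μ)» that p.357 prints in prose; FALSE (kernel counterexample with the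
# paper's own matrices (VI.6)) for the divergence form that the DISPLAYS (IV.16), (VI.2), (VI.9) print as block operators;
# the two differ by the commutator `[D_μ, D_ν]` (kernel) — with consequences for the sign of «1 + βP» recorded below

statement-level skeleton of published theorems with citation tags; proofs where landed; nothing here is a claim about the
Yang–Mills mass gap, about continuum YM₄ on T⁴, or about the Clay problem

**Citation header (reproduction of PUBLISHED work).** J. Magnen, V. Rivasseau, R. Sénéor, *Construction of YM₄ with an infrared
cutoff*, Commun. Math. Phys. **155** (1993) 325–383 [MagnenRivasseauSeneor1993]: App. 1 (A.27) p.382 tl.26–31 and p.383 tl.1–7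
[PDF 58–59]; §VI (VI.2) p.369 tl.2–3, p.369 tl.22 («D_μ = iP_μ»), (VI.6) p.369, (VI.9) p.370 [PDF 45–46]; §IV (IV.15)–(IV.16) p.356
tl.20–35 and p.357 tl.1–17 [PDF 32–33]; §V p.357 tl.31–32 (sign convention). Loci «p.NNN [PDF nn] tl.k» = journal page, PDF page
(= journal page − 324), text-layer line of the held scan `paper:magnen1993-cmp155-mrs-ym4-infrared-cutoff` (PDF sha256 fa4ddac3…);
every display quoted below was re-read on the page images (seat renders `run/shared/lean/pub/pub-balaban-gaps/pub-balaban-gaps-mrs-lit-2/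
g4/renders/p58_crop_r4300-5700_s2.png` (A.27), `p59_crop_r250-2300_s2.png`, `p32_crop_r3300-5700_s2.png` (IV.15)–(IV.16),
`p33_crop_r300-1700_s2.png` (p.357), `p45_crop_r300-1500_s2.png` (VI.2)). Cell pub-balaban-gaps (YM blitz, track G3), seat mrs-lit-2
(gen 4); companion record `run/shared/lean/pub/pub-balaban-gaps/g3/MRS-AS-PRINTED-estimates.md` §3 finding (l); exact-arithmetic
companion scripts `run/shared/lean/pub/pub-balaban-gaps/pub-balaban-gaps-mrs-lit-2/g4/a27_check.py`, `w_blocks_order.py` (+ `.out.txt`).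
Imports `MRS93LemmaVI2FeynmanGauge.lean` for the printed su(2) matrices (VI.6) `FeynmanGauge.Pmat` and (v1.1) `MRS93BosonFirstOrderVI17.lean`
for the unit-sphere blocks `BosonTrace.BFm1` of (VI.9), `PsqUnit` (VI.8), `KFPUnit` (VI.7), `nvec`. The FLAT half of (A.27) is kernel-checked in
`MRS93AppendixFeynmanGauge.lean` (`AppendixOne.ineq_A27_lower`, `ineq_A27_upper`), whose header declares the covariant half «not typed here».

**What the paper prints (verbatim, from the page images).**
* p.382 [PDF 58] tl.26–31 with (A.27): «We want also to derive a bound showing the strict positivity of −Δ_B^{homothetic} in a constant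
  field B, unless all the components of B are in the same direction in su(2) space, and p is then exactly aligned with the
  corresponding (unique) vector λB. For this we use the fact that  δ_μν D² − 10/13 ∇_μ∇_ν ≥ 3/13 D²;  δ_μν p² − 10/13 p_μp_ν ≤ 23/13 p²
  (A.27)»
* p.383 [PDF 59] tl.1–7: «in order to show that the normalized operator (−Δ_B^{homothetic})(−Δ^{homothetic})⁻¹ is bounded up to a factor
  (3/23)¹² exactly by the same bound as in the Feynman case of ordinary Laplacians. In that case we can use the explicit computations
  above to establish the necessary bounds. In particular this proves that the determinant of (−Δ_B^{homothetic})(−Δ^{homothetic})⁻¹ is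
  bounded away from 0 up to a constant factor by the bound (A.6).»
* p.357 [PDF 33] tl.3–17: «Indeed usually when one combines the quadratic piece Σ_μΣ_ν(∂_μA_ν)² − (∂_μA_ν)(∂_νA_μ) coming from F₂ with the
  homothetic gauge condition ζ(Σ_μ∂_μA_μ)(Σ_ν∂_νA_ν) one needs an integration by parts, so that the gauge condition combines with the term
  with the minus sign, leaving the term Σ_μΣ_ν(∂_μA_ν)² + (ζ − 1)Σ_μΣ_ν(∂_μA_ν)(∂_νA_μ) which corresponds to the homothetic propagator
  1/p²(δ_μν − (1 − ζ⁻¹)p_μp_ν/p²). In our case this integration by parts is no longer exact for two reasons. First the partial derivatives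
  are replaced by covariant derivatives. However if the background field is constant the reader can check that at least for su(2) the
  formula of integration by parts is still true up to a term proportional to [A′_{l,μ}, A′_{l,ν}][A′_{sμ}, A′_{sν}]. The fact that the
  field B′ₗ is piecewise constant then gives an error term containing derivatives of this field.»
* (IV.15)–(IV.16) p.356 [PDF 32]: «((∇_B̄′ₗ)_μ(A′_s)_ν − (∇_B̄′ₗ)_ν(A′_s)_μ)²_CSFR + ζ(∇_B̄′ₗ · A′_s)²_CSFR = ⟨A′_sΔ_BA′_s⟩ + L(B′ₗ, A′_s, γ). (IV.15)
  … More precisely it is defined by  Δ_B = Σ_j Σ_{Δ∈CSFR_j} Δ_{B,J,Δ},  Δ_{B,J,Δ} ≡ ((∇_B̄′ₗ)_σ(κʲ)^{1/2}χ_Δ(κʲ)^{1/2}(∇_B̄′ₗ)_σδ_μν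
  + (ζ − 1)(∇_B̄′ₗ)_μ(κʲ)^{1/2}χ_Δ(κʲ)^{1/2}(∇_B̄′ₗ)_ν). (IV.16)  This operator is clearly positive but not strictly positive (in the
  Appendix, bounds are given in the case of a constant background field).»
* (VI.2) p.369 [PDF 45]: «BF = δ_μν + κ(p)/p² × [−(D²δ_μσ − (1 − ζ)G_μD_σ)(δ_σν + (ζ⁻¹ − 1)p_σp_ν/p²) − p²δ_μν], (VI.2)» [sic: «G_μ», read
  `D_μ`]; p.369 tl.22: «We write ψ = κˢ_{i,α}(p²)/p². It is convenient to define P_μ such that D_μ = iP_μ (in Fourier space)»; (VI.6) `P_μ`;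
  (VI.9) p.370 [PDF 46], first line: «BF = δ_μν + ψ[(P²δ_μσ − (1 − ζ)P_μP_σ)(δ_σν + (ζ⁻¹ − 1)p_σp_ν/p²) − p²δ_μν]»; p.339 [PDF 15] tl.34:
  «ζ is the number close to 3/13 defining the homothetic gauge»; p.357 [PDF 33] tl.31–32: «by our convention operators such as Δ_B are
  the analogues of minus Laplacians, so that they are of positive type».

**The two quadratic forms (declared reading).** Constant background, Fourier space, `D_μ = iP_μ` with `P_μ` the Hermitian 3 × 3
matrices (VI.6); a field mode is `a = (a_μ)_{μ=0..3}`, `a_μ ∈ ℂ³`; `⟨x, y⟩ = Σ conj(xᵢ)yᵢ`. The positive operator «D²δ_μν» (i.e. `−D² = P²`,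
(VI.8), in the p.357 convention) has the form `S(a) = Σ_{μ,σ}‖P_σa_μ‖²`. For the `(1 − ζ)`-term there are TWO candidates, equal for
commuting derivatives and different for covariant ones:
  (cross)  `X(a) = Σ_{μ,ν}⟨P_νa_μ, P_μa_ν⟩` — the form of «Σ_μΣ_ν(∂_μA_ν)(∂_νA_μ)» with `∂ → D`: p.357 tl.10, the term the paper SAYS is left
           after the integration by parts; as a block operator its `(μ, ν)` block is `P_νP_μ` (`crossM_eq_sum`);
  (div)    `V(a) = ‖Σ_μP_μa_μ‖²` — the covariant gauge condition `(D·a)²` itself; as a block operator its `(μ, ν)` block is `P_μP_ν`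
           (`divSq_eq_sum`) — the index order the DISPLAYS print: (IV.16) «(∇)_μ … (∇)_ν», (VI.2) «G_μD_σ», (VI.9) «P_μP_σ».
`formCross ζ = S − (1 − ζ)X`, `formDiv ζ = S − (1 − ζ)V`; the left side of (IV.15) is `formCurv ζ = S − X + ζV` (`formCurv_eq_half_sum_sq`:
`= ½Σ‖P_μa_ν − P_νa_μ‖² + ζ‖ΣP_μa_μ‖²`, manifestly `≥ 0`). Dictionary (kernel, Hermitian `P`): `formDiv − formCross = −(1 − ζ)·C`,
`formCurv − formDiv = C`, hence `formCurv − formCross = ζ·C`, with `C(a) = Σ_{μ,ν}⟨a_μ, [P_μ, P_ν]a_ν⟩` the commutator term — p.357's «term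
proportional to [A′_{l,μ}, A′_{l,ν}][A′_{sμ}, A′_{sν}]» (`Pmat_commutator_12`: for (VI.6) the only non-zero commutator is
`[P₁, P₂] = xy·(0 1 0; −1 0 0; 0 0 0)`, the adjoint action of `λ²[B₁, B₂]`).

**What this file PROVES (kernel; zero `sorry`, zero named facts; numbers, not adjectives).**
* §1 `norm_crossTerm_le`: in ANY complex inner-product space, for any finite family `u_{μν}`, `‖Σ_{μν}⟨u_{μν}, u_{νμ}⟩‖ ≤ Σ_{μν}‖u_{μν}‖²`
  (Cauchy–Schwarz and `2ab ≤ a² + b²`, re-indexing `(μ,ν) ↔ (ν,μ)`). Hence **`A27_crossForm_lower` / `A27_crossForm_upper`**: for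
  `ζ ≤ 1`, `ζ·S ≤ S − (1 − ζ)·Re X ≤ (2 − ζ)·S` — (A.27) for the CROSS form with BOTH printed constants (`3/13 = ζ`, `23/13 = 2 − ζ` at
  `ζ = 3/13`), for arbitrary operators `P_σ` (`u_{μν} = P_νa_μ`; no Hermiticity, no su(2) needed); matrix form **`A27_crossForm_matrix`**.
  (The paper prints the constant `23/13` only for flat momenta; the same Cauchy–Schwarz gives it covariantly.)
* §3 **`A27_divForm_counterexample`**: for the DIV form (the displays' index order) (A.27) FAILS: with (VI.6) at `p = (1, 0, 0, 0)`
  (`|p| = 1`), background `x = y = 2` (`λB₁¹ = λB₂² = 2`, `t = 1`), `ζ = 3/13`, `a = (0, e₂, −e₁, 0)`: `S = 10`, `V = 16`, `X = 8`, so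
  `formDiv = 10 − (10/13)·16 = −30/13 < 0 < 30/13 = (3/13)·S` while `formCross = 50/13 ∈ [(3/13)·10, (23/13)·10]` and `formCurv = 74/13`
  (`forms_ce`, `formDiv_ce_neg`, `A27_crossForm_ce`). On the family `x = y = s` at this `a`: `formDiv = 2 + 2s² − 4(1 − ζ)s²`
  (`formDiv_family`) is negative whenever `ζ < 1/2` and `s² > 1/(1 − 2ζ)` (`formDiv_family_neg`) — so the block operator
  «P²δ_μσ − (1 − ζ)P_μP_σ» of (VI.9), read literally, is INDEFINITE at the homothetic `ζ = 3/13` for large background; `formCross =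
  2 + 2ζs²`, `formCurv = 2 + 4ζs²` there (`formCross_family`, `formCurv_family`).
* §2 the dictionary above (`divSq_eq_sum`, `crossM_eq_sum`, `formDiv_sub_formCross`, `formCurv_sub_formDiv`, `formCurv_eq_half_sum_sq`) and
  §4 `Pmat_commutator_12`, `Pmat_commutator_0`, `Pmat_commutator_3`, `Pmat_conjTranspose` ((VI.6) is Hermitian).
* §5 (v1.1) WHICH operator Sect. VI's displayed blocks compute: `BFm1Cross` (the cross-ordered analogue of `BosonTrace.BFm1` = (VI.9) first
  line); `BFm1Cross_eq_BFm1_of_one` (identical at ζ = w = 1); `BFm1Cross_sub_BFm1_11` (the `(1,1)` blocks differ by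
  `ψ(1 − ζ)(w − 1)n₁n₂xy·(0 1 0; −1 0 0; 0 0 0)`); the PRINTED «W₁₁» (VI.12f) typed verbatim (`W11printed`, reading declared) with (VI.10)
  `Uunit`, (VI.11) `VunitW`; **`W11_printed_eq_div`**: `BFm1₁₁ = ψ(U + n₁²V + W₁₁ᵖʳⁱⁿᵗᵉᵈ)` at `w = ζ⁻¹` — the printed block IS the DIV
  operator's; `W11_printed_cross_remainder`, **`W11_printed_ne_cross`**: it is NOT the cross operator's whenever
  `ψ(1 − ζ)(ζ⁻¹ − 1)n₁n₂xy ≠ 0`. So Sect. VI computes with the ordering for which §3 refutes (A.27) (record §3(l) addendum; the exact script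
  `g4/w_blocks_order.py` checks all 16 printed blocks: DIV reproduces 11/16 = finding (f), cross 8/16 and none of W₁₁, W₁₂, W₂₁, W₂₂).

**Finding (companion record §3(l); precision note — which form the authors intend is NOT decided here).** The prose p.357 tl.10 and the
bound (A.27) single out the CROSS form (for which (A.27) holds exactly with the printed constants, and which is `≥ ζ·S ≥ 0`); the displays
(IV.16)/(VI.2)/(VI.9) write the `(1 − ζ)`-blocks in the index order of the DIV form, which is not positive for `ζ < 1/2`. The two agree
to first order in `β` (the commutator blocks are off-diagonal in `μν` and of order `xy ∝ β`), so (VI.17) — re-derived exactly from (VI.9)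
as printed in `MRS93BosonFirstOrderVI17.lean` — does not separate them. Beyond first order they separate: EXACT ARITHMETIC over ℚ(i)
(seat script `g4/a27_check.py` sha16 8c2b2ffd81de7bda, output `a27_check.out.txt` sha16 b568a61a100b7319), with `BF_Q = (1 − κ)·1 +
κ·Q·(δ_σν + (ζ⁻¹ − 1)n_σn_ν)` at `|p| = 1`, `ζ = 3/13`, on 168 rational points `(n ∈ S³, t, κ ∈ {1/4, 1/2, 3/4, 1}, x ∈ {1/2, 1, 2, 3, 4,
6, 8})`: for `Q` = the DIV-form block operator (= (VI.9) read literally) `det BF < 0` at 113/168 points (0/24, 4/24, 15/24, 22/24, 24/24, 24/24,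
24/24 of the points with `x = 1/2, 1, 2, 3, 4, 6, 8`; e.g. `det BF = −50311328125/3` at `n = (1,0,0,0)`, `x = y = 2`, `κ = 1`), whereas for the CROSS-form operator and for
the (IV.15) left side `det BF > 0` at 168/168. So with (VI.9) read literally the quantity «1 + βP» of (VI.14)/(VI.16)/Lemma VI.2 changes
sign at large `β` when `ζ = 3/13` and the sentence p.383 tl.5–7 («bounded away from 0») does not follow from (A.27); with the cross form
both (A.27) and positivity hold on every sampled point. In THIS file the determinant statements are exact-arithmetic evidence of
record; (v1.2 note) on the explicit family `p = (1,0,0,0)`, `κ = 1`, `x = y = s` BOTH signs are kernel theorems in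
`MRS93HomotheticDeterminantSign.lean` (`DetSign.det_BFe0_neg`: the literal (VI.9) ordering is negative at large `s` for every `ζ < 1/2`,
`det_BFe0_homothetic = −50311328125/3`; `det_BFe0Cross_pos`: the cross ordering is positive for all `s`). The kernel content of this
file is §1–§5.

**What is NOT claimed.** Which form the authors intend (the file records both readings and what each gives); anything about (IV.16) with
its position cutoffs `χ_Δ` beyond the constant-background Fourier symbol; (A.29); Lemma VI.1/VI.2 at ζ = 3/13 in either direction; the
factor `(3/23)¹²` sentence; the integration-by-parts identity in position space (only its Fourier/constant-background shadow, §2).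
Nothing here bears on Bałaban's papers; nothing is continuum YM₄ on T⁴, nothing lifts the infrared cutoff, nothing is Clay.
-/

noncomputable section

open scoped InnerProductSpace
open Complex Matrix

namespace Literature.MathematicalPhysics.QuantumFieldTheory.MagnenRivasseauSeneor1993

namespace HomotheticA27

/-! ## §1 The Cauchy–Schwarz fact behind (A.27), in any complex inner-product space -/

section Abstract

variable {E : Type*} [NormedAddCommGroup E] [InnerProductSpace ℂ E] {ι : Type*} [Fintype ι]

/-- `S(u) = Σ_{μ,ν} ‖u_{μν}‖²` — for `u_{μν} = P_ν a_μ` this is the «D²δ_μν» form `Σ_{μ,σ}‖P_σ a_μ‖²` of (A.27). [cite: MagnenRivasseauSeneor1993, App. 1 (A.27) p.382] -/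
def gradSq (u : ι → ι → E) : ℝ := ∑ μ, ∑ ν, ‖u μ ν‖ ^ 2

/-- `X(u) = Σ_{μ,ν} ⟨u_{μν}, u_{νμ}⟩` — for `u_{μν} = P_ν a_μ` the cross term `Σ⟨P_ν a_μ, P_μ a_ν⟩` of p.357 tl.10 («(∂_μA_ν)(∂_νA_μ)»
with `∂ → D`), the `(1 − ζ)`-term of (A.27) in the cross form. [cite: MagnenRivasseauSeneor1993, §IV p.357; App. 1 (A.27) p.382] -/
def crossTerm (u : ι → ι → E) : ℂ := ∑ μ, ∑ ν, ⟪u μ ν, u ν μ⟫_ℂ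

omit [InnerProductSpace ℂ E] in
/-- `S(u) ≥ 0`. [cite: MagnenRivasseauSeneor1993, App. 1 (A.27) p.382] -/
theorem gradSq_nonneg (u : ι → ι → E) : 0 ≤ gradSq u :=
  Finset.sum_nonneg fun _ _ => Finset.sum_nonneg fun _ _ => by positivity

/-- **`|Σ⟨u_{μν}, u_{νμ}⟩| ≤ Σ‖u_{μν}‖²`** (Cauchy–Schwarz and `2ab ≤ a² + b²`, then re-indexing `(μ,ν) ↔ (ν,μ)`) — the one
inequality behind both constants of (A.27). [cite: MagnenRivasseauSeneor1993, App. 1 (A.27) p.382] -/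
theorem norm_crossTerm_le (u : ι → ι → E) : ‖crossTerm u‖ ≤ gradSq u := by
  unfold crossTerm gradSq
  have h1 : ‖∑ μ, ∑ ν, ⟪u μ ν, u ν μ⟫_ℂ‖ ≤ ∑ μ, ∑ ν, ‖u μ ν‖ * ‖u ν μ‖ := by
    refine (norm_sum_le _ _).trans (Finset.sum_le_sum fun μ _ => ?_)
    refine (norm_sum_le _ _).trans (Finset.sum_le_sum fun ν _ => ?_)
    exact norm_inner_le_norm _ _
  have h2 : ∑ μ, ∑ ν, ‖u μ ν‖ * ‖u ν μ‖ ≤ ∑ μ, ∑ ν, (‖u μ ν‖ ^ 2 + ‖u ν μ‖ ^ 2) / 2 := by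
    refine Finset.sum_le_sum fun μ _ => Finset.sum_le_sum fun ν _ => ?_
    nlinarith [sq_nonneg (‖u μ ν‖ - ‖u ν μ‖)]
  have h3 : ∑ μ, ∑ ν, (‖u μ ν‖ ^ 2 + ‖u ν μ‖ ^ 2) / 2 = ∑ μ, ∑ ν, ‖u μ ν‖ ^ 2 := by
    have hswap : ∑ μ, ∑ ν, ‖u ν μ‖ ^ 2 = ∑ μ, ∑ ν, ‖u μ ν‖ ^ 2 := Finset.sum_comm
    calc ∑ μ, ∑ ν, (‖u μ ν‖ ^ 2 + ‖u ν μ‖ ^ 2) / 2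
        = ((∑ μ, ∑ ν, ‖u μ ν‖ ^ 2) + ∑ μ, ∑ ν, ‖u ν μ‖ ^ 2) / 2 := by
          simp only [Finset.sum_add_distrib, Finset.sum_div, add_div]
      _ = ∑ μ, ∑ ν, ‖u μ ν‖ ^ 2 := by rw [hswap]; ring
  linarith

/-- The real-part version of `norm_crossTerm_le`. [cite: MagnenRivasseauSeneor1993, App. 1 (A.27) p.382] -/
theorem abs_re_crossTerm_le (u : ι → ι → E) : |(crossTerm u).re| ≤ gradSq u :=
  (Complex.abs_re_le_norm _).trans (norm_crossTerm_le u)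

/-- **(A.27), covariant half, CROSS form — lower bound** with the printed constant `3/13 = ζ`: for `ζ ≤ 1`,
`ζ·Σ‖u_{μν}‖² ≤ Σ‖u_{μν}‖² − (1 − ζ)·Re Σ⟨u_{μν}, u_{νμ}⟩`. With `u_{μν} = P_ν a_μ` (any operators `P_σ` on any complex inner-product
space): `ζ·Σ‖P_σa_μ‖² ≤ Σ‖P_σa_μ‖² − (1 − ζ)Re Σ⟨P_νa_μ, P_μa_ν⟩`. [cite: MagnenRivasseauSeneor1993, App. 1 (A.27) p.382] -/
theorem A27_crossForm_lower {ζ : ℝ} (hζ : ζ ≤ 1) (u : ι → ι → E) :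
    ζ * gradSq u ≤ gradSq u - (1 - ζ) * (crossTerm u).re := by
  have h := abs_re_crossTerm_le u
  have hre : (crossTerm u).re ≤ gradSq u := (le_abs_self _).trans h
  nlinarith

/-- **(A.27), CROSS form — upper bound** with the printed constant `23/13 = 2 − ζ`: for `ζ ≤ 1`,
`Σ‖u_{μν}‖² − (1 − ζ)·Re Σ⟨u_{μν}, u_{νμ}⟩ ≤ (2 − ζ)·Σ‖u_{μν}‖²`. (The paper prints the upper bound for flat momenta only,
«δ_μν p² − 10/13 p_μp_ν ≤ 23/13 p²»; the same constant holds covariantly.) [cite: MagnenRivasseauSeneor1993, App. 1 (A.27) p.382] -/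
theorem A27_crossForm_upper {ζ : ℝ} (hζ : ζ ≤ 1) (u : ι → ι → E) :
    gradSq u - (1 - ζ) * (crossTerm u).re ≤ (2 - ζ) * gradSq u := by
  have h := abs_re_crossTerm_le u
  have hre : -gradSq u ≤ (crossTerm u).re := by
    have := neg_abs_le (crossTerm u).re
    linarith
  nlinarith

end Abstract

/-! ## §2 The three 12 × 12 forms in matrix language (`a_μ ∈ ℂ³`, `μ ∈ Fin 4`; `⟨x, y⟩ = star x ⬝ᵥ y`) -/

section Forms

variable (P : Fin 4 → Matrix (Fin 3) (Fin 3) ℂ) (a : Fin 4 → Fin 3 → ℂ)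

/-- `Σ_{μ,σ} ‖P_σ a_μ‖²` — the form of «D²δ_μν» (`−D² = P² = Σ_σP_σ²`, (VI.8)). [cite: MagnenRivasseauSeneor1993, §VI (VI.8) p.370] -/
def formLap : ℂ := ∑ μ, ∑ σ, star (P σ *ᵥ a μ) ⬝ᵥ (P σ *ᵥ a μ)

/-- `‖Σ_μ P_μ a_μ‖²` — the covariant gauge condition squared (DIV form), the form of the block operator `(μ,ν) ↦ P_μP_ν`
(`divSq_eq_sum`) — the index order of the displays «G_μD_σ» [sic] (VI.2), «P_μP_σ» (VI.9), «(∇)_μ…(∇)_ν» (IV.16).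
[cite: MagnenRivasseauSeneor1993, §VI (VI.2), (VI.9) pp.369–370; §IV (IV.16) p.356] -/
def divSq : ℂ := star (∑ μ, P μ *ᵥ a μ) ⬝ᵥ (∑ μ, P μ *ᵥ a μ)

/-- `Σ_{μ,ν} ⟨P_ν a_μ, P_μ a_ν⟩` — the CROSS term «(∂_μA_ν)(∂_νA_μ)» of p.357 tl.4 and tl.10 with `∂ → D`, the form of the block
operator `(μ,ν) ↦ P_νP_μ` (`crossM_eq_sum`). [cite: MagnenRivasseauSeneor1993, §IV p.357] -/
def crossM : ℂ := ∑ μ, ∑ ν, star (P ν *ᵥ a μ) ⬝ᵥ (P μ *ᵥ a ν)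

/-- DIV form of the homothetic operator: `Σ‖P_σa_μ‖² − (1 − ζ)‖ΣP_μa_μ‖²` — «P²δ_μσ − (1 − ζ)P_μP_σ» of (VI.9) read literally as a
block operator (likewise (VI.2), (IV.16)). [cite: MagnenRivasseauSeneor1993, §VI (VI.2), (VI.9) pp.369–370; §IV (IV.16) p.356] -/
def formDiv (ζ : ℝ) : ℂ := formLap P a - (1 - ζ) * divSq P a

/-- CROSS form of the homothetic operator: `Σ‖P_σa_μ‖² − (1 − ζ)Σ⟨P_νa_μ, P_μa_ν⟩` — «Σ_μΣ_ν(∂_μA_ν)² + (ζ − 1)Σ_μΣ_ν(∂_μA_ν)(∂_νA_μ)»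
of p.357 tl.10 with `∂ → D` (block operator `(μ,ν) ↦ P²δ_μν − (1 − ζ)P_νP_μ`). [cite: MagnenRivasseauSeneor1993, §IV p.357; App. 1 (A.27) p.382] -/
def formCross (ζ : ℝ) : ℂ := formLap P a - (1 - ζ) * crossM P a

/-- The left side of (IV.15), `((∇)_μA_ν − (∇)_νA_μ)² + ζ(∇·A)²`, with the curvature square normalised as the paper's own
«quadratic piece Σ_μΣ_ν(∂_μA_ν)² − (∂_μA_ν)(∂_νA_μ) coming from F₂» (p.357 tl.4; `= ½Σ_{μν}‖P_μa_ν − P_νa_μ‖²`, i.e. the sum over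
`μ < ν`): `Σ‖P_σa_μ‖² − Σ⟨P_νa_μ, P_μa_ν⟩ + ζ‖ΣP_μa_μ‖²` (`formCurv_eq_half_sum_sq`). [cite: MagnenRivasseauSeneor1993, §IV (IV.15) p.356, p.357] -/
def formCurv (ζ : ℝ) : ℂ := formLap P a - crossM P a + ζ * divSq P a

variable {P a}

/-- `⟨Ax, By⟩ = ⟨x, (AᴴB)y⟩` (plumbing for the block-operator dictionary of (IV.15)/(VI.9)). [cite: MagnenRivasseauSeneor1993, §VI (VI.9) p.370] -/
theorem star_mulVec_dotProduct_mulVec (A B : Matrix (Fin 3) (Fin 3) ℂ) (x y : Fin 3 → ℂ) :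
    star (A *ᵥ x) ⬝ᵥ (B *ᵥ y) = star x ⬝ᵥ ((Aᴴ * B) *ᵥ y) := by
  rw [star_mulVec, ← dotProduct_mulVec, mulVec_mulVec]

/-- For Hermitian `P_μ`: `‖ΣP_μa_μ‖² = Σ_{μν}⟨a_μ, P_μP_ν a_ν⟩` — the DIV form is the block operator `(μ,ν) ↦ P_μP_ν`, the index
order of «P²δ_μσ − (1 − ζ)P_μP_σ» (VI.9). [cite: MagnenRivasseauSeneor1993, §VI (VI.9) p.370] -/
theorem divSq_eq_sum (hP : ∀ μ, (P μ)ᴴ = P μ) :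
    divSq P a = ∑ μ, ∑ ν, star (a μ) ⬝ᵥ ((P μ * P ν) *ᵥ a ν) := by
  unfold divSq
  rw [star_sum, sum_dotProduct]
  refine Finset.sum_congr rfl fun μ _ => ?_
  rw [dotProduct_sum]
  refine Finset.sum_congr rfl fun ν _ => ?_
  rw [star_mulVec_dotProduct_mulVec, hP]

/-- For Hermitian `P_μ`: `Σ⟨P_νa_μ, P_μa_ν⟩ = Σ_{μν}⟨a_μ, P_νP_μ a_ν⟩` — the CROSS form is the block operator `(μ,ν) ↦ P_νP_μ`.
[cite: MagnenRivasseauSeneor1993, §IV p.357; §VI (VI.9) p.370] -/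
theorem crossM_eq_sum (hP : ∀ μ, (P μ)ᴴ = P μ) :
    crossM P a = ∑ μ, ∑ ν, star (a μ) ⬝ᵥ ((P ν * P μ) *ᵥ a ν) := by
  unfold crossM
  refine Finset.sum_congr rfl fun μ _ => Finset.sum_congr rfl fun ν _ => ?_
  rw [star_mulVec_dotProduct_mulVec, hP]

/-- **DIV form minus CROSS form = the commutator term**: for Hermitian `P_μ`,
`formDiv − formCross = −(1 − ζ)·Σ_{μν}⟨a_μ, [P_μ, P_ν] a_ν⟩` — the «term proportional to [A′_{l,μ}, A′_{l,ν}][A′_{sμ}, A′_{sν}]»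
of p.357 tl.15–16 (with `Pmat_commutator_12` below). [cite: MagnenRivasseauSeneor1993, §IV p.357] -/
theorem formDiv_sub_formCross (hP : ∀ μ, (P μ)ᴴ = P μ) (ζ : ℝ) :
    formDiv P a ζ - formCross P a ζ =
      -(1 - ζ) * ∑ μ, ∑ ν, star (a μ) ⬝ᵥ ((P μ * P ν - P ν * P μ) *ᵥ a ν) := by
  unfold formDiv formCross
  rw [divSq_eq_sum hP, crossM_eq_sum hP]
  simp only [sub_mulVec, dotProduct_sub, Finset.sum_sub_distrib]
  ring

/-- **(IV.15) left side minus the DIV form = the commutator term** (for Hermitian `P_μ`):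
`formCurv − formDiv = Σ_{μν}⟨a_μ, [P_μ, P_ν] a_ν⟩` (so `formCurv − formCross = ζ·Σ⟨a_μ,[P_μ,P_ν]a_ν⟩`).
[cite: MagnenRivasseauSeneor1993, §IV (IV.15) p.356, p.357] -/
theorem formCurv_sub_formDiv (hP : ∀ μ, (P μ)ᴴ = P μ) (ζ : ℝ) :
    formCurv P a ζ - formDiv P a ζ = ∑ μ, ∑ ν, star (a μ) ⬝ᵥ ((P μ * P ν - P ν * P μ) *ᵥ a ν) := by
  unfold formCurv formDiv
  rw [divSq_eq_sum hP, crossM_eq_sum hP]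
  simp only [sub_mulVec, dotProduct_sub, Finset.sum_sub_distrib]
  ring

/-- The left side of (IV.15) as printed, `Σ_{μν}‖P_μa_ν − P_νa_μ‖²·½ + ζ‖ΣP_μa_μ‖²`, equals `formCurv` (pure algebra, any `P`).
[cite: MagnenRivasseauSeneor1993, §IV (IV.15) p.356] -/
theorem formCurv_eq_half_sum_sq (ζ : ℝ) :
    formCurv P a ζ = (1 / 2) * ∑ μ, ∑ ν, star (P μ *ᵥ a ν - P ν *ᵥ a μ) ⬝ᵥ (P μ *ᵥ a ν - P ν *ᵥ a μ)
      + ζ * divSq P a := by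
  unfold formCurv formLap crossM
  have hswap : ∑ μ : Fin 4, ∑ ν : Fin 4, star (P μ *ᵥ a ν) ⬝ᵥ (P μ *ᵥ a ν)
      = ∑ μ : Fin 4, ∑ ν : Fin 4, star (P ν *ᵥ a μ) ⬝ᵥ (P ν *ᵥ a μ) := Finset.sum_comm
  have hswap2 : ∑ μ : Fin 4, ∑ ν : Fin 4, star (P μ *ᵥ a ν) ⬝ᵥ (P ν *ᵥ a μ)
      = ∑ μ : Fin 4, ∑ ν : Fin 4, star (P ν *ᵥ a μ) ⬝ᵥ (P μ *ᵥ a ν) := Finset.sum_comm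
  simp only [star_sub, sub_dotProduct, dotProduct_sub, Finset.sum_sub_distrib]
  rw [hswap, hswap2]
  ring

/-! ### The bridge to §1: the CROSS form obeys (A.27) for ANY matrices `P_σ` -/

/-- `u_{μν} := P_ν a_μ` as vectors of `ℂ³ = EuclideanSpace ℂ (Fin 3)` (to apply §1 to the matrices of (VI.6)/(VI.9)). [cite: MagnenRivasseauSeneor1993, App. 1 (A.27) p.382] -/
def uOf (P : Fin 4 → Matrix (Fin 3) (Fin 3) ℂ) (a : Fin 4 → Fin 3 → ℂ) : Fin 4 → Fin 4 → EuclideanSpace ℂ (Fin 3) :=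
  fun μ ν => WithLp.toLp 2 (P ν *ᵥ a μ)

/-- `star x ⬝ᵥ y = ⟨x, y⟩` in `EuclideanSpace ℂ (Fin 3)` (plumbing). [cite: MagnenRivasseauSeneor1993, App. 1 (A.27) p.382] -/
theorem star_dotProduct_eq_inner (x y : Fin 3 → ℂ) :
    star x ⬝ᵥ y = ⟪WithLp.toLp 2 x, WithLp.toLp 2 y⟫_ℂ := by
  rw [EuclideanSpace.inner_toLp_toLp, dotProduct_comm]

/-- The matrix cross term is §1's `crossTerm` of `u_{μν} = P_νa_μ`. [cite: MagnenRivasseauSeneor1993, App. 1 (A.27) p.382] -/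
theorem crossM_eq_crossTerm : crossM P a = crossTerm (uOf P a) := by
  unfold crossM crossTerm uOf
  simp only [star_dotProduct_eq_inner]

/-- The matrix Laplacian form is §1's `gradSq` of `u_{μν} = P_νa_μ` (as a real number cast to `ℂ`). [cite: MagnenRivasseauSeneor1993, App. 1 (A.27) p.382] -/
theorem formLap_eq_gradSq : formLap P a = ((gradSq (uOf P a) : ℝ) : ℂ) := by
  unfold formLap gradSq uOf
  simp only [Complex.ofReal_sum, Complex.ofReal_pow, star_dotProduct_eq_inner, inner_self_eq_norm_sq_to_K]
  rfl

/-- Real part of `formLap`. [cite: MagnenRivasseauSeneor1993, App. 1 (A.27) p.382] -/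
theorem formLap_re : (formLap P a).re = gradSq (uOf P a) := by
  rw [formLap_eq_gradSq, Complex.ofReal_re]

/-- Real part of the cross form in §1's variables. [cite: MagnenRivasseauSeneor1993, App. 1 (A.27) p.382] -/
theorem formCross_re (ζ : ℝ) :
    (formCross P a ζ).re = gradSq (uOf P a) - (1 - ζ) * (crossTerm (uOf P a)).re := by
  unfold formCross
  rw [Complex.sub_re, formLap_re, crossM_eq_crossTerm]
  simp [Complex.mul_re]

/-- **(A.27), covariant, CROSS form, for arbitrary 3 × 3 complex matrices `P₀,…,P₃` and all `a`** (in particular for the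
su(2) matrices (VI.6) at every momentum and every constant background): for `ζ ≤ 1`,
`ζ·Re Σ‖P_σa_μ‖² ≤ Re[Σ‖P_σa_μ‖² − (1 − ζ)Σ⟨P_νa_μ, P_μa_ν⟩] ≤ (2 − ζ)·Re Σ‖P_σa_μ‖²` — at `ζ = 3/13` the printed «≥ 3/13 D²» and
«≤ 23/13 …». [cite: MagnenRivasseauSeneor1993, App. 1 (A.27) p.382] -/
theorem A27_crossForm_matrix {ζ : ℝ} (hζ : ζ ≤ 1) (P : Fin 4 → Matrix (Fin 3) (Fin 3) ℂ) (a : Fin 4 → Fin 3 → ℂ) :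
    ζ * (formLap P a).re ≤ (formCross P a ζ).re ∧ (formCross P a ζ).re ≤ (2 - ζ) * (formLap P a).re := by
  rw [formCross_re, formLap_re]
  exact ⟨A27_crossForm_lower hζ _, A27_crossForm_upper hζ _⟩

end Forms

/-! ## §3 The DIV form (the displays' index order) violates (A.27): an explicit counterexample with the matrices (VI.6) -/

section Counterexample

/-- The test vector `a = (a₀, a₁, a₂, a₃) = (0, e₂, −e₁, 0)` (`e_j` the standard basis of the su(2) = ℂ³ colour space) used in the
counterexample to the DIV-form reading of (A.27). [cite: MagnenRivasseauSeneor1993, App. 1 (A.27) p.382] -/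
def aCE : Fin 4 → Fin 3 → ℂ := ![![0, 0, 0], ![0, 1, 0], ![-1, 0, 0], ![0, 0, 0]]

/-- The matrices (VI.6) at momentum `p = (1, 0, 0, 0)` and background `λB₁¹ = λB₂² = s` (`x = y = s`, i.e. `t = 1`).
[cite: MagnenRivasseauSeneor1993, §VI (VI.6) p.369] -/
def Pfam (s : ℝ) : Fin 4 → Matrix (Fin 3) (Fin 3) ℂ := FeynmanGauge.Pmat 1 0 0 0 s s

/-- `Σ_{μ,σ}‖P_σa_μ‖² = 2 + 2s²` on the family. [cite: MagnenRivasseauSeneor1993, §VI (VI.6), (VI.8) pp.369–370] -/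
theorem formLap_family (s : ℝ) : formLap (Pfam s) aCE = ((2 + 2 * s ^ 2 : ℝ) : ℂ) := by
  unfold formLap Pfam aCE
  simp [Fin.sum_univ_four, FeynmanGauge.Pmat, Matrix.mulVec, dotProduct, Fin.sum_univ_three]
  linear_combination (-2 * (s : ℂ) ^ 2) * Complex.I_mul_I

/-- `‖Σ_μP_μa_μ‖² = 4s²` on the family (the covariant divergence of `a` is `(0, 0, 2is)`). [cite: MagnenRivasseauSeneor1993, §VI (VI.6), (VI.9) pp.369–370] -/
theorem divSq_family (s : ℝ) : divSq (Pfam s) aCE = ((4 * s ^ 2 : ℝ) : ℂ) := by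
  unfold divSq Pfam aCE
  simp [Fin.sum_univ_four, FeynmanGauge.Pmat, Matrix.mulVec, dotProduct, Fin.sum_univ_three]
  linear_combination (-4 * (s : ℂ) ^ 2) * Complex.I_mul_I

/-- `Σ⟨P_νa_μ, P_μa_ν⟩ = 2s²` on the family. [cite: MagnenRivasseauSeneor1993, §VI (VI.6) p.369; §IV p.357] -/
theorem crossM_family (s : ℝ) : crossM (Pfam s) aCE = ((2 * s ^ 2 : ℝ) : ℂ) := by
  unfold crossM Pfam aCE
  simp [Fin.sum_univ_four, FeynmanGauge.Pmat, Matrix.mulVec, dotProduct, Fin.sum_univ_three]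
  linear_combination (-2 * (s : ℂ) ^ 2) * Complex.I_mul_I

/-- **The DIV form on the family**: `2 + 2s² − 4(1 − ζ)s²`. [cite: MagnenRivasseauSeneor1993, §VI (VI.2), (VI.6), (VI.9) pp.369–370; App. 1 (A.27) p.382] -/
theorem formDiv_family (ζ s : ℝ) :
    formDiv (Pfam s) aCE ζ = ((2 + 2 * s ^ 2 - (1 - ζ) * (4 * s ^ 2) : ℝ) : ℂ) := by
  unfold formDiv
  rw [formLap_family, divSq_family]
  push_cast
  ring

/-- The CROSS form on the family: `2 + 2ζs²` (`≥ ζ(2 + 2s²)`, as §1 guarantees). [cite: MagnenRivasseauSeneor1993, App. 1 (A.27) p.382] -/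
theorem formCross_family (ζ s : ℝ) :
    formCross (Pfam s) aCE ζ = ((2 + 2 * ζ * s ^ 2 : ℝ) : ℂ) := by
  unfold formCross
  rw [formLap_family, crossM_family]
  push_cast
  ring

/-- The (IV.15) left side on the family: `2 + 4ζs²`. [cite: MagnenRivasseauSeneor1993, §IV (IV.15) p.356] -/
theorem formCurv_family (ζ s : ℝ) :
    formCurv (Pfam s) aCE ζ = ((2 + 4 * ζ * s ^ 2 : ℝ) : ℂ) := by
  unfold formCurv
  rw [formLap_family, crossM_family, divSq_family]
  push_cast
  ring

/-- **The DIV form is indefinite for every `ζ < 1/2`** (in particular at the homothetic `ζ = 3/13`): at `x = y = s` with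
`s² > 1/(1 − 2ζ)` it is negative on `a = aCE`. [cite: MagnenRivasseauSeneor1993, §VI (VI.2), (VI.9) pp.369–370; §IV (IV.16) p.356] -/
theorem formDiv_family_neg {ζ s : ℝ} (hζ : ζ < 1 / 2) (hs : 1 / (1 - 2 * ζ) < s ^ 2) :
    (formDiv (Pfam s) aCE ζ).re < 0 := by
  rw [formDiv_family, Complex.ofReal_re]
  have h12 : 0 < 1 - 2 * ζ := by linarith
  have hs' : 1 < s ^ 2 * (1 - 2 * ζ) := by
    have := (div_lt_iff₀ h12).mp hs
    linarith
  nlinarith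

/-- **The counterexample of record** (`ζ = 3/13`, `p = (1,0,0,0)`, `x = y = 2`, `a = (0, e₂, −e₁, 0)`):
`Σ‖P_σa_μ‖² = 10`, `‖ΣP_μa_μ‖² = 16`, DIV form `= −30/13`, CROSS form `= 50/13`, (IV.15) left side `= 74/13`.
[cite: MagnenRivasseauSeneor1993, App. 1 (A.27) p.382; §VI (VI.2), (VI.6) p.369] -/
theorem forms_ce :
    formLap (Pfam 2) aCE = 10 ∧ divSq (Pfam 2) aCE = 16 ∧ formDiv (Pfam 2) aCE (3 / 13) = -30 / 13 ∧
      formCross (Pfam 2) aCE (3 / 13) = 50 / 13 ∧ formCurv (Pfam 2) aCE (3 / 13) = 74 / 13 := by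
  refine ⟨?_, ?_, ?_, ?_, ?_⟩
  · rw [formLap_family]; push_cast; norm_num
  · rw [divSq_family]; push_cast; norm_num
  · rw [formDiv_family]; push_cast; norm_num
  · rw [formCross_family]; push_cast; norm_num
  · rw [formCurv_family]; push_cast; norm_num

/-- … numerically: the DIV form is NEGATIVE there. [cite: MagnenRivasseauSeneor1993, App. 1 (A.27) p.382] -/
theorem formDiv_ce_neg : (formDiv (Pfam 2) aCE (3 / 13)).re < 0 := by
  rw [forms_ce.2.2.1]
  norm_num

/-- **(A.27)'s covariant half FAILS for the DIV form** (the index order «P_μP_σ» of (VI.9), «(∇)_μ…(∇)_ν» of (IV.16)): at the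
counterexample point `¬ ((3/13)·Σ‖P_σa_μ‖² ≤ Σ‖P_σa_μ‖² − (10/13)‖ΣP_μa_μ‖²)` (`30/13 ≰ −30/13`). Contrast `A27_crossForm_matrix`.
[cite: MagnenRivasseauSeneor1993, App. 1 (A.27) p.382] -/
theorem A27_divForm_counterexample :
    ¬ ((3 / 13 : ℝ) * (formLap (Pfam 2) aCE).re ≤ (formDiv (Pfam 2) aCE (3 / 13)).re) := by
  rw [forms_ce.1, forms_ce.2.2.1]
  norm_num

/-- … while at the same point the CROSS form satisfies both printed bounds: `(3/13)·10 ≤ 50/13 ≤ (23/13)·10`. [cite: MagnenRivasseauSeneor1993, App. 1 (A.27) p.382] -/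
theorem A27_crossForm_ce :
    (3 / 13 : ℝ) * (formLap (Pfam 2) aCE).re ≤ (formCross (Pfam 2) aCE (3 / 13)).re ∧
      (formCross (Pfam 2) aCE (3 / 13)).re ≤ (23 / 13 : ℝ) * (formLap (Pfam 2) aCE).re := by
  rw [forms_ce.1, forms_ce.2.2.2.1]
  norm_num

end Counterexample

/-! ## §4 The commutators of the matrices (VI.6): `[P₁, P₂] = xy·ad([e₁, e₂])`, all other pairs commute -/

section Commutators

open FeynmanGauge

/-- **`[P₁, P₂] = xy·(0 1 0; −1 0 0; 0 0 0)`** for the matrices (VI.6) (every momentum, every two-component background): the only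
non-vanishing commutator, the adjoint action of `λ²[B₁, B₂]` — p.357's «term proportional to [A′_{l,μ}, A′_{l,ν}]…».
[cite: MagnenRivasseauSeneor1993, §VI (VI.6) p.369; §IV p.357] -/
theorem Pmat_commutator_12 (p₀ p₁ p₂ p₃ x y : ℝ) :
    Pmat p₀ p₁ p₂ p₃ x y 1 * Pmat p₀ p₁ p₂ p₃ x y 2 - Pmat p₀ p₁ p₂ p₃ x y 2 * Pmat p₀ p₁ p₂ p₃ x y 1 =
      !![0, (x * y : ℂ), 0; -(x * y : ℂ), 0, 0; 0, 0, 0] := by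
  ext i j
  fin_cases i <;> fin_cases j <;> simp [Pmat] <;> ring_nf <;> simp [Complex.I_sq]

/-- `P₀ = p₀·1` commutes with every `P_ν`. [cite: MagnenRivasseauSeneor1993, §VI (VI.6) p.369] -/
theorem Pmat_commutator_0 (p₀ p₁ p₂ p₃ x y : ℝ) (ν : Fin 4) :
    Pmat p₀ p₁ p₂ p₃ x y 0 * Pmat p₀ p₁ p₂ p₃ x y ν - Pmat p₀ p₁ p₂ p₃ x y ν * Pmat p₀ p₁ p₂ p₃ x y 0 = 0 := by
  ext i j
  fin_cases ν <;> fin_cases i <;> fin_cases j <;> simp [Pmat] <;> ring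

/-- `P₃ = p₃·1` commutes with every `P_ν`. [cite: MagnenRivasseauSeneor1993, §VI (VI.6) p.369] -/
theorem Pmat_commutator_3 (p₀ p₁ p₂ p₃ x y : ℝ) (ν : Fin 4) :
    Pmat p₀ p₁ p₂ p₃ x y 3 * Pmat p₀ p₁ p₂ p₃ x y ν - Pmat p₀ p₁ p₂ p₃ x y ν * Pmat p₀ p₁ p₂ p₃ x y 3 = 0 := by
  ext i j
  fin_cases ν <;> fin_cases i <;> fin_cases j <;> simp [Pmat] <;> ring

/-- The matrices (VI.6) are Hermitian (real momenta and background), so §2's dictionary applies to them.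
[cite: MagnenRivasseauSeneor1993, §VI (VI.6), (VI.8) pp.369–370 («The hermitian matrix −D² = P²»)] -/
theorem Pmat_conjTranspose (p₀ p₁ p₂ p₃ x y : ℝ) (μ : Fin 4) :
    (Pmat p₀ p₁ p₂ p₃ x y μ)ᴴ = Pmat p₀ p₁ p₂ p₃ x y μ := by
  ext i j
  fin_cases μ <;> fin_cases i <;> fin_cases j <;> simp [Pmat, Matrix.conjTranspose_apply, Complex.conj_ofReal]

end Commutators


/-! ## §5 (v1.1) Which operator do the PRINTED blocks of Sect. VI compute? — the block `W₁₁` (VI.12f) AS PRINTED is the DIV operator's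

(VI.9) p.370 writes `BF = δ_μν[1 + ψU] + ψ(p_μp_ν/p²)V + ψW_μν` and prints `U` (VI.10), `V` (VI.11), `W_μν` (VI.12a–j). On the unit momentum
sphere (`p_μ → n_μ`, `1/ζ → w`) the DIV operator's block `(μ,ν)` is `BosonTrace.BFm1` of `MRS93BosonFirstOrderVI17.lean` ((VI.9) first line
read literally, `P_μP_ν` and `P_μ(Σ_σn_σP_σ)`); the CROSS operator's block is `BFm1Cross` below (`P_νP_μ` and `(Σ_σn_σP_σ)P_μ`). Their
`(1,1)` blocks differ by `ψ(1 − ζ)(w − 1)n₁n₂xy·(0 1 0; −1 0 0; 0 0 0)` (`BFm1Cross_sub_BFm1_11`), and the PRINTED `W₁₁` (VI.12f) is exactly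
the DIV block's `W` (`W11_printed_eq_div`, with `ζw = 1`), hence NOT the cross block's whenever `(1 − ζ)(w − 1)n₁n₂xy ≠ 0`
(`W11_printed_ne_cross`). So the computation displayed in Sect. VI is carried out with the form for which §3 refutes (A.27); at `ζ = 1`
(`w = 1`) the two operators coincide (`BFm1Cross_eq_BFm1_of_one`). -/

section WhichOperator

open FeynmanGauge BosonTrace

/-- The CROSS-ordered analogue of `BosonTrace.BFm1` ((VI.9) first line with the `(1 − ζ)`-blocks transposed): block `(μ, ν)` of
`ψ[Σ_σ(P²δ_μσ − (1 − ζ)P_σP_μ)(δ_σν + (w − 1)n_σn_ν) − δ_μν]` on the unit sphere, i.e.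
`ψ[(δ_μν + (w − 1)n_μn_ν)P² − (1 − ζ)(P_νP_μ + (w − 1)n_ν(Σ_σn_σP_σ)P_μ) − δ_μν·1]`.
[cite: MagnenRivasseauSeneor1993, §VI (VI.9) p.370; §IV p.357] -/
def BFm1Cross (ζ w ψ x y n₀ n₁ n₂ n₃ : ℝ) (μ ν : Fin 4) : Matrix (Fin 3) (Fin 3) ℂ :=
  (ψ : ℂ) • ((((if μ = ν then (1 : ℝ) else 0) + (w - 1) * nvec n₀ n₁ n₂ n₃ μ * nvec n₀ n₁ n₂ n₃ ν : ℝ) : ℂ) • PsqUnit n₁ n₂ x y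
      - ((1 - ζ : ℝ) : ℂ) • (Pmat n₀ n₁ n₂ n₃ x y ν * Pmat n₀ n₁ n₂ n₃ x y μ
          + (((w - 1) * nvec n₀ n₁ n₂ n₃ ν : ℝ) : ℂ) • (KFPUnit n₁ n₂ x y * Pmat n₀ n₁ n₂ n₃ x y μ))
      - ((if μ = ν then (1 : ℝ) else 0 : ℝ) : ℂ) • (1 : Matrix (Fin 3) (Fin 3) ℂ))

/-- **At ζ = 1 (and `w = ζ⁻¹ = 1`) the DIV and CROSS operators coincide** (block by block): everything the paper PROVES (App. 1, ζ = 1)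
is insensitive to the ordering. [cite: MagnenRivasseauSeneor1993, §VI (VI.9) p.370; App. 1 p.378] -/
theorem BFm1Cross_eq_BFm1_of_one (ψ x y n₀ n₁ n₂ n₃ : ℝ) (μ ν : Fin 4) :
    BFm1Cross 1 1 ψ x y n₀ n₁ n₂ n₃ μ ν = BFm1 1 1 ψ x y n₀ n₁ n₂ n₃ μ ν := by
  simp [BFm1Cross, BFm1]

/-- **The `(1,1)` blocks of the CROSS and DIV operators differ by the commutator**:
`BFm1Cross₁₁ − BFm1₁₁ = ψ(1 − ζ)(w − 1)n₁n₂xy·(0 1 0; −1 0 0; 0 0 0)` (`= −ψ(1 − ζ)(w − 1)n₁[Σ_σn_σP_σ, P₁]`, and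
`[Σ_σn_σP_σ, P₁] = n₂[P₂, P₁]`, cf. `Pmat_commutator_12`). [cite: MagnenRivasseauSeneor1993, §VI (VI.9), (VI.12f) pp.370–371; §IV p.357] -/
theorem BFm1Cross_sub_BFm1_11 (ζ w ψ x y n₀ n₁ n₂ n₃ : ℝ) :
    BFm1Cross ζ w ψ x y n₀ n₁ n₂ n₃ 1 1 - BFm1 ζ w ψ x y n₀ n₁ n₂ n₃ 1 1 =
      ((ψ * (1 - ζ) * (w - 1) * n₁ * n₂ * x * y : ℝ) : ℂ) • !![0, 1, 0; -1, 0, 0; 0, 0, 0] := by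
  ext i j
  fin_cases i <;> fin_cases j <;> simp [BFm1Cross, BFm1, PsqUnit, KFPUnit, Pmat, nvec] <;> ring_nf <;>
    simp only [Complex.I_sq] <;> ring

/-- (VI.10) on the unit sphere: `U = P² − p² = (y² 0 2in₂y; 0 x² −2in₁x; −2in₂y 2in₁x x² + y²)`.
[cite: MagnenRivasseauSeneor1993, §VI (VI.10) p.370] -/
def Uunit (n₁ n₂ x y : ℝ) : Matrix (Fin 3) (Fin 3) ℂ :=
  !![(y : ℂ) * y, 0, 2 * I * n₂ * y; 0, (x : ℂ) * x, -(2 * I * n₁ * x); -(2 * I * n₂ * y), 2 * I * n₁ * x, (x : ℂ) * x + (y : ℂ) * y]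

/-- (VI.11) on the unit sphere, with `1/ζ` written `w`: «V = ((1/ζ − 1)y² 0 (1/ζ − ζ)ip₂y; 0 (1/ζ − 1)x² −(1/ζ − ζ)ip₁x; −(1/ζ − ζ)ip₂y
(1/ζ − ζ)ip₁x (1/ζ − 1)(x² + y²))» (cf. `FeynmanGauge.Vmat`). [cite: MagnenRivasseauSeneor1993, §VI (VI.11) p.370] -/
def VunitW (ζ w x y n₁ n₂ : ℝ) : Matrix (Fin 3) (Fin 3) ℂ :=
  !![((w - 1) * y ^ 2 : ℝ), 0, ((w - ζ : ℝ) : ℂ) * I * n₂ * y;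
    0, ((w - 1) * x ^ 2 : ℝ), -(((w - ζ : ℝ) : ℂ) * I * n₁ * x);
    -(((w - ζ : ℝ) : ℂ) * I * n₂ * y), ((w - ζ : ℝ) : ℂ) * I * n₁ * x, ((w - 1) * (x ^ 2 + y ^ 2) : ℝ)]

/-- **(VI.12f) AS PRINTED** (p.371 [PDF 47], image `p47_crop_r300-2900_s2.png`), on the unit sphere with `1/ζ` written `w` where it occurs
as `(ζ − 1/ζ)`, and `(1 − ζ)²/ζ` kept as printed: «W₁₁ = ( 0 [;] xy (1 − ζ)²/ζ p₁p₂/p² [;] 0  |  0, 0 ; −x²[(1 − ζ)²/ζ p₁²/p² + (1 − ζ)],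
−ip₁x(ζ − 1/ζ) ; ip₁x(ζ − 1/ζ), −x²[(1 − ζ)²/ζ p₁²/p² + (1 − ζ)] ), (VI.12f)» — READING (declared, as in the companion record §3(f)): the
first printed triple `(0; xy(1−ζ)²/ζ·p₁p₂/p²; 0)` is the first COLUMN, the following 3 × 2 array the columns 2–3; i.e.
row 1 = `(0, 0, 0)`, row 2 = `(xy(1−ζ)²/ζ·n₁n₂, −x²[(1−ζ)²/ζ·n₁² + (1−ζ)], −in₁x(ζ − w))`, row 3 = `(0, in₁x(ζ − w), −x²[(1−ζ)²/ζ·n₁² + (1−ζ)])`.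
[cite: MagnenRivasseauSeneor1993, §VI (VI.12f) p.371] -/
def W11printed (ζ w x y n₁ n₂ : ℝ) : Matrix (Fin 3) (Fin 3) ℂ :=
  !![0, 0, 0;
    ((x * y * ((1 - ζ) ^ 2 / ζ) * n₁ * n₂ : ℝ) : ℂ), ((-(x ^ 2 * ((1 - ζ) ^ 2 / ζ * n₁ ^ 2 + (1 - ζ))) : ℝ) : ℂ),
      -(I * n₁ * x * ((ζ - w : ℝ) : ℂ));
    0, I * n₁ * x * ((ζ - w : ℝ) : ℂ), ((-(x ^ 2 * ((1 - ζ) ^ 2 / ζ * n₁ ^ 2 + (1 - ζ))) : ℝ) : ℂ)]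

/-- **The printed `W₁₁` (VI.12f) is the DIV operator's block**: with `w = ζ⁻¹` (`ζ ≠ 0`),
`BFm1₁₁ = ψ·(U + n₁²·V + W₁₁ᵖʳⁱⁿᵗᵉᵈ)` — (VI.9) second line for the block `(1,1)`, with (VI.10), (VI.11), (VI.12f) as printed.
[cite: MagnenRivasseauSeneor1993, §VI (VI.9)–(VI.12f) pp.370–371] -/
theorem W11_printed_eq_div {ζ : ℝ} (hζ : ζ ≠ 0) (ψ x y n₀ n₁ n₂ n₃ : ℝ) :
    BFm1 ζ ζ⁻¹ ψ x y n₀ n₁ n₂ n₃ 1 1 =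
      (ψ : ℂ) • (Uunit n₁ n₂ x y + ((n₁ ^ 2 : ℝ) : ℂ) • VunitW ζ ζ⁻¹ x y n₁ n₂ + W11printed ζ ζ⁻¹ x y n₁ n₂) := by
  have hζ' : (ζ : ℂ) ≠ 0 := by exact_mod_cast hζ
  unfold BFm1
  congr 1
  ext i j
  fin_cases i <;> fin_cases j <;> simp [PsqUnit, KFPUnit, Pmat, nvec, Uunit, VunitW, W11printed] <;>
    field_simp <;> ring_nf <;> (try simp only [Complex.I_sq]) <;> (try ring_nf)

/-- … whereas for the CROSS operator the same decomposition leaves a non-zero remainder: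
`BFm1Cross₁₁ − ψ·(U + n₁²·V + W₁₁ᵖʳⁱⁿᵗᵉᵈ) = ψ(1 − ζ)(ζ⁻¹ − 1)n₁n₂xy·(0 1 0; −1 0 0; 0 0 0)`.
[cite: MagnenRivasseauSeneor1993, §VI (VI.9)–(VI.12f) pp.370–371; §IV p.357] -/
theorem W11_printed_cross_remainder {ζ : ℝ} (hζ : ζ ≠ 0) (ψ x y n₀ n₁ n₂ n₃ : ℝ) :
    BFm1Cross ζ ζ⁻¹ ψ x y n₀ n₁ n₂ n₃ 1 1 -
        (ψ : ℂ) • (Uunit n₁ n₂ x y + ((n₁ ^ 2 : ℝ) : ℂ) • VunitW ζ ζ⁻¹ x y n₁ n₂ + W11printed ζ ζ⁻¹ x y n₁ n₂) =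
      ((ψ * (1 - ζ) * (ζ⁻¹ - 1) * n₁ * n₂ * x * y : ℝ) : ℂ) • !![0, 1, 0; -1, 0, 0; 0, 0, 0] := by
  rw [← W11_printed_eq_div hζ, BFm1Cross_sub_BFm1_11]

/-- The `(1,2)` colour entry of that remainder: `ψ(1 − ζ)(ζ⁻¹ − 1)n₁n₂xy`. [cite: MagnenRivasseauSeneor1993, §VI (VI.9)–(VI.12f) pp.370–371] -/
theorem W11_printed_cross_remainder_entry {ζ : ℝ} (hζ : ζ ≠ 0) (ψ x y n₀ n₁ n₂ n₃ : ℝ) :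
    (BFm1Cross ζ ζ⁻¹ ψ x y n₀ n₁ n₂ n₃ 1 1 -
        (ψ : ℂ) • (Uunit n₁ n₂ x y + ((n₁ ^ 2 : ℝ) : ℂ) • VunitW ζ ζ⁻¹ x y n₁ n₂ + W11printed ζ ζ⁻¹ x y n₁ n₂)) 0 1 =
      ((ψ * (1 - ζ) * (ζ⁻¹ - 1) * n₁ * n₂ * x * y : ℝ) : ℂ) := by
  rw [W11_printed_cross_remainder hζ]
  simp

/-- **Hence the printed (VI.12f) is NOT the cross operator's block** whenever `ψ(1 − ζ)(ζ⁻¹ − 1)n₁n₂xy ≠ 0` — e.g. at the homothetic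
`ζ = 3/13` for any momentum with `n₁n₂ ≠ 0` and any background with `xy ≠ 0`: Sect. VI's displayed computation uses the DIV ordering.
[cite: MagnenRivasseauSeneor1993, §VI (VI.9)–(VI.12f) pp.370–371] -/
theorem W11_printed_ne_cross {ζ ψ x y n₁ n₂ : ℝ} (hζ : ζ ≠ 0) (h : ψ * (1 - ζ) * (ζ⁻¹ - 1) * n₁ * n₂ * x * y ≠ 0) (n₀ n₃ : ℝ) :
    BFm1Cross ζ ζ⁻¹ ψ x y n₀ n₁ n₂ n₃ 1 1 ≠
      (ψ : ℂ) • (Uunit n₁ n₂ x y + ((n₁ ^ 2 : ℝ) : ℂ) • VunitW ζ ζ⁻¹ x y n₁ n₂ + W11printed ζ ζ⁻¹ x y n₁ n₂) := by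
  intro heq
  have h0 := W11_printed_cross_remainder_entry hζ ψ x y n₀ n₁ n₂ n₃
  rw [heq, sub_self, Matrix.zero_apply] at h0
  exact h (by exact_mod_cast h0.symm)

end WhichOperator

end HomotheticA27

end Literature.MathematicalPhysics.QuantumFieldTheory.MagnenRivasseauSeneor1993
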